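import Literature.MathematicalPhysics.QuantumLattice.DualUnitaryGates
import Literature.Computability.QuantumComplexity.PauliExpansion
import Mathlib.Analysis.SpecialFunctions.Trigonometric.Basic
import Mathlib.Analysis.SpecialFunctions.Trigonometric.Series
import Mathlib.Analysis.Normed.Algebra.MatrixExponential
import HarnessLib

/-!
# The kicked-Ising two-qubit gate is dual-unitary at `J = b = π/4`, for every field `h`

Companion to `DualUnitaryGates.lean` (0 facts, 0 sorry): the IDENTIFICATION step that file left
open, for the gate of register row E-36 (pub-qadeq lane; honest framing: instance-level adjudication
of specific advantage claims; no claim about BQP vs BPP or the summit). Fischer et al.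
[FischerEtAl2026] (held text `paper:arxiv-2411.00765` p0003): kicked Ising model
`H_I = J Σ Z_n Z_{n+1} + h Σ Z_n`, kick `H_K = b Σ X_n`, Floquet `U_KI = e^{−iH_K} e^{−iH_I}`,
"For `J = b = π/4`, the gates are dual unitary for any choice of `h` [Aki-16]". Bertini–Kos–Prosen
[BertiniKosProsen2019] SM §4 (held text `paper:arxiv-1904.02140`, equation numbers from the arXiv v3
TeX): the bond gate `U_KI = e^{−iJσᶻ⊗σᶻ}(e^{−ihσᶻ}e^{−ibσˣ}e^{−ihσᶻ} ⊗ e^{−ibσˣ})e^{−iJσᶻ⊗σᶻ}`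
(SM-32) is, "at the self dual points `|J| = |b| = π/4`" (SM-34), of the dual-unitary form (23)
(eqs. (SM-35)–(SM-36), main text eq. (25) `U_SDKI`).

## What is formalised (qubits indexed by `Bool`, `false = |0⟩`)

* the factors in closed form: `zRot h = e^{−ihσᶻ} = diag(e^{−ih}, e^{ih})`, `xKick b = e^{−ibσˣ} =
  cos b·𝟙 − i sin b·σˣ` (the standard closed form of the exponential of an involution, Nielsen–Chuang
  eq. (4.4)), `zzPhase J = e^{−iJσᶻ⊗σᶻ} = diag(e^{−iJ s₁s₂})`, and `gate J b h` = (SM-32); the three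
  factors ARE Mathlib's matrix exponentials `NormedSpace.exp (−ih • σᶻ)`, `NormedSpace.exp (−ib • σˣ)`,
  `NormedSpace.exp (−iJ • σᶻ⊗σᶻ)` (`exp_Z_eq_zRot`, `exp_X_eq_xKick`, `exp_ZZ_eq_zzPhase`);
* `gate_eq_conj_gate_zero`: `U_KI(J,b,h) = (e^{−ihσᶻ} ⊗ 𝟙)·U_KI(J,b,0)·(e^{−ihσᶻ} ⊗ 𝟙)` — the field
  `h` is a single-site dressing because diagonal gates commute;
* `gate_selfDual_zero`: `U_KI(π/4,π/4,0) = e^{−iπ/2}(S ⊗ S)·C·(S ⊗ S)` with the Clifford core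
  `C = CZ·(e^{−i(π/4)σˣ})^{⊗2}·CZ = ½·CZ(𝟙 − iσˣ)^{⊗2}CZ`, using `e^{−i(π/4)σᶻσᶻ} = e^{−iπ/4}(S⊗S)CZ`
  and `e^{−i(π/4)σˣ} = (√2/2)(𝟙 − iσˣ)`;
* the core is dual-unitary by an exact `4 × 4` check over `ℤ[i]/2` (both `C C† = 𝟙` and
  `C̃ C̃† = 𝟙` for the printed dual `C̃`, `DualUnitary.dualGate`), whence
  **`isDualUnitary_gate_selfDual_zero`** and, by `IsDualUnitary.conj_local` / `IsDualUnitary.smul`,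
  **`isDualUnitary_gate_selfDual (h)`: the `J = b = π/4` gate is dual-unitary for EVERY `h`** — the
  printed sentence; `trace_sameSite_gate_selfDual_eq_zero`: its one-gate light-cone consequence;
* all four self-dual points "`|J| = |b| = π/4`" (SM-34): `gate_neg_b` (`b ↦ −b` is conjugation by
  `σᶻ ⊗ σᶻ`), `gate_neg_J` (`J ↦ −J` is conjugation by `σˣ ⊗ 𝟙` together with `h ↦ −h`), hence
  **`isDualUnitary_gate_of_abs_eq`: `|J| = |b| = π/4 ⇒ U_KI(J,b,h)` is dual-unitary for every `h`**;
* the light-cone channel `M₊(a) = ½ tr₁[U†(a⊗𝟙)U]` (Bertini–Kos–Prosen eq. (18), the tree's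
  `DualUnitary.mPlus`) of the self-dual gate: linearity and dressing lemmas for `M₊` (`mPlus_add`,
  `mPlus_smul_arg`, `mPlus_phase_smul`, `mPlus_kron_one_conj`), the Heisenberg rotation
  `e^{ihσᶻ}σˣe^{−ihσᶻ} = cos(2h)σˣ − sin(2h)σʸ`, the Clifford-point values `M₊(σˣ) = σˣ`,
  `M₊(σʸ) = 0`, whence **`mPlus_gate_selfDual_X`: `M₊[U_KI(π/4,π/4,h)](σˣ) = cos(2h)·σˣ`** for
  every `h` — `σˣ` is an eigen-operator with eigenvalue `cos 2h` — and
  `half_trace_X_mul_iterate_mPlus_gate_selfDual`: `½ Tr[σˣ M₊^t(σˣ)] = [cos(2h)]^t`, the printed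
  light-cone decay of Fischer et al. eq. (2) AT THE LEVEL OF THE ONE-GATE CHANNEL.

## What is NOT formalised

The brickwork circuit on `N` qubits and Bertini–Kos–Prosen's many-body Properties 1–2 (eq. (12):
zero off the light cone; eq. (17): the light-cone correlator equals `(1/d) tr[M_ν^{#layers}(a^β)a^α]`),
so `C_n(t) = [cos 2h]^t δ_{n,t}` itself (Fischer eq. (2)) is NOT a tree theorem — only its one-gate
ingredients (dual-unitarity for every `h`, and the eigen-relation `M₊(σˣ) = cos(2h)σˣ`) are; the
left mover `M₋` and the full spectrum of `M_±` (SM §5); anything about noise, error mitigation or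
the tensor-network comparison of register row E-36.
-/

noncomputable section

open Matrix Complex
open scoped Kronecker
open Literature.Computability.QuantumComplexity
open Literature.InformationTheory.Entanglement.TwoCopy

namespace Literature.MathematicalPhysics.QuantumLattice

namespace DualUnitary

namespace KickedIsing

/-! ### The gates of the kicked Ising Floquet circuit (qubits indexed by `Bool`, `false = |0⟩`) -/

/-- `σᶻ` eigenvalue of a basis state: `|0⟩ ↦ +1`, `|1⟩ ↦ −1` (so `σᶻ = diag(zSign)`,
`mat_Z_eq_diagonal`). [cite: NielsenChuang2010, §2.1.3 (Pauli `Z = diag(1, −1)`)] -/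
def zSign (a : Bool) : ℂ := if a then -1 else 1

/-- `σᶻ = diag(1, −1)`. [cite: BertiniKosProsen2019, text before eq. (26) (Pauli basis
`{𝟙, σˣ, σʸ, σᶻ}`)] -/
theorem mat_Z_eq_diagonal : Pauli.mat Pauli.Z = diagonal zSign := by
  ext a b
  cases a <;> cases b <;> simp [zSign, diagonal]

/-- The longitudinal-field rotation `e^{−i h σᶻ} = diag(e^{−ih}, e^{ih})`.
[cite: BertiniKosProsen2019, SM §4 eq. (SM-27) (`U_I = e^{−iJσᶻ⊗σᶻ}(e^{−ihσᶻ} ⊗ 𝟙)`)] -/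
def zRot (h : ℝ) : Matrix Bool Bool ℂ := diagonal fun a => cexp (-(I * h * zSign a))

/-- The transverse kick `e^{−i b σˣ} = cos b · 𝟙 − i sin b · σˣ` (closed form of the exponential of
an involution). [cite: BertiniKosProsen2019, SM §4 eq. (SM-28) (`U_K = e^{−ibσˣ}`)]
[cite: NielsenChuang2010, eq. (4.4) (`R_x(θ) = e^{−iθX/2} = cos(θ/2) I − i sin(θ/2) X`)] -/
def xKick (b : ℝ) : Matrix Bool Bool ℂ :=
  (Real.cos b : ℂ) • (1 : Matrix Bool Bool ℂ) - (I * Real.sin b) • Pauli.mat Pauli.X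

/-- The Ising coupling `e^{−i J σᶻ⊗σᶻ} = diag(e^{−iJ s₁s₂})`. [cite: BertiniKosProsen2019, SM §4
eq. (SM-27)] -/
def zzPhase (J : ℝ) : Matrix (Bool × Bool) (Bool × Bool) ℂ :=
  diagonal fun p => cexp (-(I * J * (zSign p.1 * zSign p.2)))

/-- **The kicked-Ising two-qubit gate** (one Floquet period restricted to a bond, symmetric split
of the Ising term): `U_KI = e^{−iJσᶻ⊗σᶻ} (e^{−ihσᶻ} e^{−ibσˣ} e^{−ihσᶻ} ⊗ e^{−ibσˣ}) e^{−iJσᶻ⊗σᶻ}`.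
[cite: BertiniKosProsen2019, SM §4 eq. (SM-32)] [cite: FischerEtAl2026, main text (kicked Ising
`H_I = J Σ Z_n Z_{n+1} + h Σ Z_n`, kick `H_K = b Σ X_n`, Floquet `U_KI = e^{−iH_K} e^{−iH_I}`,
"the two-qubit building blocks are specified by the model parameters h, J, and b")] -/
def gate (J b h : ℝ) : Matrix (Bool × Bool) (Bool × Bool) ℂ :=
  zzPhase J * ((zRot h * xKick b * zRot h) ⊗ₖ xKick b) * zzPhase J

/-! ### Elementary facts about the one-qubit factors -/

/-- `zRot 0 = 𝟙`. [folklore] -/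
private theorem zRot_zero : zRot 0 = 1 := by
  unfold zRot
  simp

/-- `e^{−ihσᶻ}` has unimodular diagonal entries. [folklore] -/
private theorem zRot_entry_mul_star (h : ℝ) (a : Bool) :
    cexp (-(I * h * zSign a)) * star (cexp (-(I * h * zSign a))) = 1 := by
  rw [Complex.star_def, ← Complex.exp_conj, ← Complex.exp_add]
  have : -(I * (h : ℂ) * zSign a) + (starRingEnd ℂ) (-(I * (h : ℂ) * zSign a)) = 0 := by
    cases a <;> simp [zSign, Complex.conj_ofReal]
  rw [this, Complex.exp_zero]

/-- A diagonal matrix with unimodular entries is unitary. [folklore] -/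
private theorem diagonal_mem_unitaryGroup' {ι : Type*} [Fintype ι] [DecidableEq ι] (d : ι → ℂ)
    (hd : ∀ p, d p * star (d p) = 1) : Matrix.diagonal d ∈ Matrix.unitaryGroup ι ℂ := by
  rw [Matrix.mem_unitaryGroup_iff, Matrix.star_eq_conjTranspose, Matrix.diagonal_conjTranspose,
    Matrix.diagonal_mul_diagonal, ← Matrix.diagonal_one]
  congr 1
  funext p
  rw [Pi.star_apply, hd p]

/-- `e^{−ihσᶻ}` is unitary. [cite: BertiniKosProsen2019, SM §4 eq. (SM-27)] -/
theorem zRot_mem_unitaryGroup (h : ℝ) : zRot h ∈ Matrix.unitaryGroup Bool ℂ :=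
  diagonal_mem_unitaryGroup' _ (zRot_entry_mul_star h)

/-- The phase gate `S = diag(1, i)`. [cite: NielsenChuang2010, §4.2 (phase gate `S`)] -/
def sGate : Matrix Bool Bool ℂ := diagonal fun a => if a then I else 1

/-- `S` is unitary. [cite: NielsenChuang2010, §4.2] -/
theorem sGate_mem_unitaryGroup : sGate ∈ Matrix.unitaryGroup Bool ℂ :=
  diagonal_mem_unitaryGroup' _ fun a => by cases a <;> simp

/-- The controlled-`Z` gate `CZ = diag(1, 1, 1, −1)`. [cite: NielsenChuang2010, §4.3 (controlled-Z)] -/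
def czGate : Matrix (Bool × Bool) (Bool × Bool) ℂ :=
  diagonal fun p => if p.1 && p.2 then -1 else 1

/-- `√2 · e^{−i(π/4)σˣ} = 𝟙 − iσˣ`. [folklore] -/
private def aMat : Matrix Bool Bool ℂ := 1 - I • Pauli.mat Pauli.X

/-- Entries of `𝟙 − iσˣ`. [folklore] -/
private theorem aMat_apply (a b : Bool) : aMat a b = if a = b then 1 else -I := by
  cases a <;> cases b <;> simp [aMat]

/-! ### The self-dual point `J = b = π/4`: factorisation into Clifford pieces -/

/-- `e^{−i(π/4)σˣ} = (√2/2)(𝟙 − iσˣ)`. [folklore] -/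
private theorem xKick_pi_div_four : xKick (Real.pi / 4) = ((Real.sqrt 2 / 2 : ℝ) : ℂ) • aMat := by
  unfold xKick aMat
  rw [Real.cos_pi_div_four, Real.sin_pi_div_four, smul_sub, smul_smul, mul_comm]

/-- `(√2/2)² = 1/2` in `ℂ`. [folklore] -/
private theorem sqrt_two_half_sq : ((Real.sqrt 2 / 2 : ℝ) : ℂ) * ((Real.sqrt 2 / 2 : ℝ) : ℂ) = 1 / 2 := by
  rw [← Complex.ofReal_mul, div_mul_div_comm, Real.mul_self_sqrt (by norm_num : (0 : ℝ) ≤ 2)]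
  push_cast
  norm_num

/-- `e^{−i(π/4)σˣ} ⊗ e^{−i(π/4)σˣ} = ½ (𝟙 − iσˣ) ⊗ (𝟙 − iσˣ)`. [folklore] -/
private theorem xKick_kronecker_xKick :
    xKick (Real.pi / 4) ⊗ₖ xKick (Real.pi / 4) = (1 / 2 : ℂ) • (aMat ⊗ₖ aMat) := by
  rw [xKick_pi_div_four, Matrix.smul_kronecker, Matrix.kronecker_smul, smul_smul, sqrt_two_half_sq]

/-- `e^{iπ/4} = i · e^{−iπ/4}`. [folklore] -/
private theorem exp_quarter_turn :
    cexp (I * ((Real.pi : ℂ) / 4)) = I * cexp (-(I * ((Real.pi : ℂ) / 4))) := by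
  have hI : cexp (((Real.pi : ℂ) / 2) * I) = I := by
    rw [Complex.exp_mul_I, Complex.cos_pi_div_two, Complex.sin_pi_div_two, one_mul, zero_add]
  calc cexp (I * ((Real.pi : ℂ) / 4))
      = cexp (((Real.pi : ℂ) / 2) * I + -(I * ((Real.pi : ℂ) / 4))) := by congr 1; ring
    _ = cexp (((Real.pi : ℂ) / 2) * I) * cexp (-(I * ((Real.pi : ℂ) / 4))) := Complex.exp_add _ _
    _ = I * cexp (-(I * ((Real.pi : ℂ) / 4))) := by rw [hI]

/-- **`e^{−i(π/4)σᶻ⊗σᶻ} = e^{−iπ/4} (S ⊗ S) · CZ`.** [folklore] -/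
private theorem zzPhase_pi_div_four :
    zzPhase (Real.pi / 4) = cexp (-(I * (Real.pi / 4 : ℝ))) • ((sGate ⊗ₖ sGate) * czGate) := by
  unfold zzPhase sGate czGate
  rw [Matrix.diagonal_kronecker_diagonal, Matrix.diagonal_mul_diagonal, ← Matrix.diagonal_smul]
  congr 1
  funext p
  rcases p with ⟨a, b⟩
  cases a <;> cases b <;> simp [zSign] <;> exact exp_quarter_turn.trans (mul_comm _ _)

/-- Diagonal gates commute: `CZ · (S ⊗ S) = (S ⊗ S) · CZ`. [folklore] -/
private theorem czGate_mul_sKron : czGate * (sGate ⊗ₖ sGate) = (sGate ⊗ₖ sGate) * czGate := by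
  unfold czGate sGate
  rw [Matrix.diagonal_kronecker_diagonal, Matrix.diagonal_mul_diagonal, Matrix.diagonal_mul_diagonal]
  congr 1
  funext p
  ring

/-- **The Clifford core** `C = ½ · CZ (𝟙 − iσˣ)^{⊗2} CZ = CZ (e^{−i(π/4)σˣ} ⊗ e^{−i(π/4)σˣ}) CZ`.
[folklore] -/
private def core : Matrix (Bool × Bool) (Bool × Bool) ℂ :=
  (1 / 2 : ℂ) • (czGate * (aMat ⊗ₖ aMat) * czGate)

/-- Entries of the core. [folklore] -/
private theorem core_apply (p q : Bool × Bool) :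
    core p q = (1 / 2 : ℂ) * ((if p.1 && p.2 then -1 else 1) *
      ((if p.1 = q.1 then 1 else -I) * (if p.2 = q.2 then 1 else -I)) *
      (if q.1 && q.2 then -1 else 1)) := by
  unfold core czGate
  rw [Matrix.smul_apply, smul_eq_mul, Matrix.mul_diagonal, Matrix.diagonal_mul,
    Matrix.kroneckerMap_apply, aMat_apply, aMat_apply]

/-- The core is unitary (a 4 × 4 check over `ℤ[i]/2`). [folklore] -/
private theorem core_mul_conjTranspose : core * coreᴴ = 1 := by
  ext ⟨p1, p2⟩ ⟨r1, r2⟩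
  simp only [Matrix.mul_apply, Matrix.conjTranspose_apply, core_apply, Fintype.sum_prod_type,
    Fintype.sum_bool, Matrix.one_apply, Prod.mk.injEq]
  cases p1 <;> cases p2 <;> cases r1 <;> cases r2 <;> norm_num [Complex.ext_iff]

/-- The dual of the core is unitary as well. [folklore] -/
private theorem dualGate_core_mul_conjTranspose : dualGate core * (dualGate core)ᴴ = 1 := by
  ext ⟨p1, p2⟩ ⟨r1, r2⟩
  simp only [Matrix.mul_apply, Matrix.conjTranspose_apply, dualGate_apply, core_apply,
    Fintype.sum_prod_type, Fintype.sum_bool, Matrix.one_apply, Prod.mk.injEq]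
  cases p1 <;> cases p2 <;> cases r1 <;> cases r2 <;> norm_num [Complex.ext_iff]

/-- **The Clifford core is dual-unitary.** [folklore] -/
private theorem isDualUnitary_core : IsDualUnitary core := by
  refine ⟨Matrix.mem_unitaryGroup_iff.mpr ?_, Matrix.mem_unitaryGroup_iff.mpr ?_⟩
  · rw [Matrix.star_eq_conjTranspose, core_mul_conjTranspose]
  · rw [Matrix.star_eq_conjTranspose, dualGate_core_mul_conjTranspose]

/-! ### Assembly: global phase, single-site dressing, and the gate at `J = b = π/4` -/

/-- A global phase does not affect dual-unitarity (the `e^{iφ}` in the parametrisation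
`U = e^{iφ}(u₊ ⊗ u₋)·V[J]·(v₋ ⊗ v₊)`). [cite: BertiniKosProsen2019, eq. (23)] -/
theorem _root_.Literature.MathematicalPhysics.QuantumLattice.DualUnitary.IsDualUnitary.smul
    {m : Type*} [Fintype m] [DecidableEq m] {U : Matrix (m × m) (m × m) ℂ} (hU : IsDualUnitary U)
    {c : ℂ} (hc : c * star c = 1) : IsDualUnitary (c • U) := by
  have key : ∀ {V : Matrix (m × m) (m × m) ℂ}, V ∈ Matrix.unitaryGroup (m × m) ℂ →
      c • V ∈ Matrix.unitaryGroup (m × m) ℂ := fun {V} hV => by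
    rw [Matrix.mem_unitaryGroup_iff] at hV ⊢
    rw [star_smul, Matrix.smul_mul, Matrix.mul_smul, smul_smul, hV, hc, one_smul]
  have hd : dualGate (c • U) = c • dualGate U := by
    ext ⟨k, l⟩ ⟨i, j⟩
    simp [dualGate_apply]
  exact ⟨key hU.1, by rw [hd]; exact key hU.2⟩

/-- `|e^{−iθ}| = 1`. [folklore] -/
private theorem phase_mul_star (θ : ℝ) : cexp (-(I * θ)) * star (cexp (-(I * θ))) = 1 := by
  rw [Complex.star_def, ← Complex.exp_conj, ← Complex.exp_add]
  have : -(I * (θ : ℂ)) + (starRingEnd ℂ) (-(I * (θ : ℂ))) = 0 := by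
    simp [Complex.conj_ofReal]
  rw [this, Complex.exp_zero]

/-- `zRot h ⊗ 𝟙` commutes with the Ising coupling (both are diagonal). [folklore] -/
private theorem zzPhase_mul_zRot_kronecker_one (J h : ℝ) :
    zzPhase J * (zRot h ⊗ₖ (1 : Matrix Bool Bool ℂ)) = (zRot h ⊗ₖ (1 : Matrix Bool Bool ℂ)) * zzPhase J := by
  unfold zzPhase zRot
  rw [← Matrix.diagonal_one, Matrix.diagonal_kronecker_diagonal, Matrix.diagonal_mul_diagonal,
    Matrix.diagonal_mul_diagonal]
  congr 1
  funext p
  ring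

/-- **The longitudinal field is a single-site dressing**: `U_KI(J,b,h) = (e^{−ihσᶻ} ⊗ 𝟙) ·
U_KI(J,b,0) · (e^{−ihσᶻ} ⊗ 𝟙)`, because `e^{−ihσᶻ} ⊗ 𝟙` commutes with `e^{−iJσᶻ⊗σᶻ}`.
[cite: BertiniKosProsen2019, SM §4 eqs. (SM-32), (SM-35) (the `h`-rotations are pulled outside
at the self-dual point)] -/
theorem gate_eq_conj_gate_zero (J b h : ℝ) :
    gate J b h = (zRot h ⊗ₖ (1 : Matrix Bool Bool ℂ)) * gate J b 0 *
      (zRot h ⊗ₖ (1 : Matrix Bool Bool ℂ)) := by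
  unfold gate
  rw [zRot_zero, Matrix.one_mul, Matrix.mul_one,
    show (zRot h * xKick b * zRot h) ⊗ₖ xKick b =
      (zRot h ⊗ₖ (1 : Matrix Bool Bool ℂ)) * (xKick b ⊗ₖ xKick b) *
        (zRot h ⊗ₖ (1 : Matrix Bool Bool ℂ)) by
      rw [← Matrix.mul_kronecker_mul, ← Matrix.mul_kronecker_mul, Matrix.one_mul, Matrix.mul_one]]
  simp only [← Matrix.mul_assoc]
  rw [zzPhase_mul_zRot_kronecker_one]
  simp only [Matrix.mul_assoc]
  rw [zzPhase_mul_zRot_kronecker_one]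

/-- **At `J = b = π/4`, `h = 0` the gate is, up to the global phase `e^{−iπ/2}`, the Clifford core
dressed by phase gates**: `U_KI(π/4, π/4, 0) = e^{−iπ/2} (S ⊗ S) · [CZ (e^{−i(π/4)σˣ})^{⊗2} CZ] · (S ⊗ S)`.
[cite: BertiniKosProsen2019, SM §4 eqs. (SM-34)–(SM-36) (`|J| = |b| = π/4`: `U_SDKI` is of the
dual-unitary form (23))] -/
theorem gate_selfDual_zero :
    gate (Real.pi / 4) (Real.pi / 4) 0 =
      (cexp (-(I * (Real.pi / 4 : ℝ))) * cexp (-(I * (Real.pi / 4 : ℝ)))) •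
        ((sGate ⊗ₖ sGate) * core * (sGate ⊗ₖ sGate)) := by
  unfold gate core
  rw [zRot_zero, Matrix.one_mul, Matrix.mul_one, xKick_kronecker_xKick, zzPhase_pi_div_four]
  simp only [Matrix.smul_mul, Matrix.mul_smul, smul_smul, Matrix.mul_assoc]
  rw [czGate_mul_sKron]
  congr 1
  ring

/-- **The kicked-Ising gate at `J = b = π/4`, `h = 0` is dual-unitary.**
[cite: BertiniKosProsen2019, eq. (25) and SM §4 eqs. (SM-34)–(SM-36)] -/
theorem isDualUnitary_gate_selfDual_zero : IsDualUnitary (gate (Real.pi / 4) (Real.pi / 4) 0) := by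
  rw [gate_selfDual_zero]
  refine (isDualUnitary_core.conj_local sGate_mem_unitaryGroup sGate_mem_unitaryGroup
    sGate_mem_unitaryGroup sGate_mem_unitaryGroup).smul ?_
  rw [star_mul', mul_mul_mul_comm, phase_mul_star, one_mul]

/-- **"For `J = b = π/4`, the gates are dual unitary for any choice of `h`."** The kicked-Ising
two-qubit gate `e^{−iJσᶻσᶻ}(e^{−ihσᶻ}e^{−ibσˣ}e^{−ihσᶻ} ⊗ e^{−ibσˣ})e^{−iJσᶻσᶻ}` at `J = b = π/4` is
dual-unitary for every longitudinal field `h` — the `h`-dependence is a single-site dressing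
(`gate_eq_conj_gate_zero`), which preserves dual-unitarity (`IsDualUnitary.conj_local`).
[cite: FischerEtAl2026, main text ("For J = b = π/4, the gates are dual unitary for any choice of
h")] [cite: BertiniKosProsen2019, eq. (25) (`U_SDKI`) and SM §4 ("at the self dual points
|J| = |b| = π/4")] -/
theorem isDualUnitary_gate_selfDual (h : ℝ) : IsDualUnitary (gate (Real.pi / 4) (Real.pi / 4) h) := by
  rw [gate_eq_conj_gate_zero]
  exact isDualUnitary_gate_selfDual_zero.conj_local (zRot_mem_unitaryGroup h) (Submonoid.one_mem _)
    (zRot_mem_unitaryGroup h) (Submonoid.one_mem _)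

/-- Hence, for traceless single-site `a` and any `b'`, the same-site one-gate infinite-temperature
correlator through the `J = b = π/4` kicked-Ising gate vanishes for every `h` (the one-gate step of
`C_n(t) = 0` off the light cone). [cite: FischerEtAl2026, eq. (2) (`C_n(t) = 0` unless `n = t`)]
[cite: BertiniKosProsen2019, Property 1 / eq. (12)] -/
theorem trace_sameSite_gate_selfDual_eq_zero (h : ℝ) {a : Matrix Bool Bool ℂ} (ha : a.trace = 0)
    (b' : Matrix Bool Bool ℂ) :
    ((b' ⊗ₖ (1 : Matrix Bool Bool ℂ)) * (gate (Real.pi / 4) (Real.pi / 4) h *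
      (a ⊗ₖ (1 : Matrix Bool Bool ℂ)) * (gate (Real.pi / 4) (Real.pi / 4) h)ᴴ)).trace = 0 :=
  trace_sameSite_eq_zero_of_isDualUnitary (isDualUnitary_gate_selfDual h) ha b'

/-! ### The closed forms are the matrix exponentials

The one- and two-qubit factors were introduced above in closed form; here they are identified with
Mathlib's matrix exponential `NormedSpace.exp` (the power series in the matrix algebra), so that
`gate J b h` is literally the printed
`e^{−iJσᶻ⊗σᶻ}(e^{−ihσᶻ}e^{−ibσˣ}e^{−ihσᶻ} ⊗ e^{−ibσˣ})e^{−iJσᶻ⊗σᶻ}` (eq. (SM-32)). -/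

/-- Mathlib's `NormedSpace.exp` on `ℂ` is `Complex.exp`. [folklore] -/
private theorem cexp_eq_exp (z : ℂ) : NormedSpace.exp z = cexp z :=
  (congr_fun Complex.exp_eq_exp_ℂ z).symm

/-- **`e^{−ihσᶻ} = diag(e^{−ih}, e^{ih})`** as a matrix exponential. [cite: BertiniKosProsen2019,
SM §4 eq. (SM-27) (`U_I = e^{−iJσᶻ⊗σᶻ}(e^{−ihσᶻ} ⊗ 𝟙)`)] [cite: NielsenChuang2010, eq. (4.6)
(`R_z(θ) = e^{−iθZ/2} = diag(e^{−iθ/2}, e^{iθ/2})`)] -/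
theorem exp_Z_eq_zRot (h : ℝ) :
    NormedSpace.exp ((-(I * h) : ℂ) • Pauli.mat Pauli.Z) = zRot h := by
  rw [mat_Z_eq_diagonal, ← Matrix.diagonal_smul, Matrix.exp_diagonal, Pi.exp_def]
  unfold zRot
  congr 1
  funext a
  rw [Pi.smul_apply, smul_eq_mul, cexp_eq_exp]
  congr 1
  ring

/-- **`e^{−iJσᶻ⊗σᶻ} = diag(e^{−iJ s₁s₂})`** as a matrix exponential. [cite: BertiniKosProsen2019,
SM §4 eq. (SM-27)] -/
theorem exp_ZZ_eq_zzPhase (J : ℝ) :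
    NormedSpace.exp ((-(I * J) : ℂ) • (Pauli.mat Pauli.Z ⊗ₖ Pauli.mat Pauli.Z)) = zzPhase J := by
  rw [mat_Z_eq_diagonal, Matrix.diagonal_kronecker_diagonal, ← Matrix.diagonal_smul,
    Matrix.exp_diagonal, Pi.exp_def]
  unfold zzPhase
  congr 1
  funext p
  rw [Pi.smul_apply, smul_eq_mul, cexp_eq_exp]
  congr 1
  ring

/-- `e^{−iθP} = cos θ · 𝟙 − i sin θ · P` for an involution `P² = 𝟙`: the even terms of the
exponential series sum to `cos θ · 𝟙`, the odd ones to `−i sin θ · P`. [cite: NielsenChuang2010,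
eq. (4.4) and Exercise 4.2 (`exp(iAx) = cos(x) I + i sin(x) A` for `A² = I`)] -/
private theorem exp_neg_I_mul_smul_of_mul_self {n : Type*} [Fintype n] [DecidableEq n]
    (P : Matrix n n ℂ) (hP : P * P = 1) (θ : ℝ) :
    NormedSpace.exp ((-(I * θ) : ℂ) • P) =
      (Real.cos θ : ℂ) • (1 : Matrix n n ℂ) - (I * Real.sin θ) • P := by
  set z : ℂ := -(I * θ) with hz
  rw [congrFun (NormedSpace.exp_eq_tsum ℂ) _]
  refine HasSum.tsum_eq ?_
  have hPeven : ∀ k : ℕ, P ^ (2 * k) = 1 := fun k => by rw [pow_mul, sq, hP, one_pow]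
  have hPodd : ∀ k : ℕ, P ^ (2 * k + 1) = P := fun k => by rw [pow_succ, hPeven, one_mul]
  have key : ∀ k : ℕ, ((Nat.factorial k : ℂ)⁻¹) • (z • P) ^ k =
      (z ^ k / (Nat.factorial k : ℂ)) • P ^ k := by
    intro k
    rw [smul_pow, smul_smul, div_eq_inv_mul]
  simp_rw [key]
  have hz2 : z ^ 2 = -((θ : ℂ) ^ 2) := by
    rw [hz, neg_sq, mul_pow, Complex.I_sq]; ring
  have he : HasSum (fun k : ℕ => (z ^ (2 * k) / (Nat.factorial (2 * k) : ℂ)) • P ^ (2 * k))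
      ((Complex.cos (θ : ℂ)) • (1 : Matrix n n ℂ)) := by
    simp_rw [hPeven]
    refine HasSum.smul_const ?_ _
    have hfun : (fun k : ℕ => z ^ (2 * k) / (Nat.factorial (2 * k) : ℂ)) =
        fun k : ℕ => (-1) ^ k * (θ : ℂ) ^ (2 * k) / (Nat.factorial (2 * k) : ℂ) := by
      funext k
      rw [pow_mul, hz2, neg_pow, ← pow_mul]
    rw [hfun]
    exact Complex.hasSum_cos _
  have ho : HasSum (fun k : ℕ => (z ^ (2 * k + 1) / (Nat.factorial (2 * k + 1) : ℂ)) •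
      P ^ (2 * k + 1)) ((-I * Complex.sin (θ : ℂ)) • P) := by
    simp_rw [hPodd]
    refine HasSum.smul_const ?_ _
    have hfun : (fun k : ℕ => z ^ (2 * k + 1) / (Nat.factorial (2 * k + 1) : ℂ)) =
        fun k : ℕ => -I * ((-1) ^ k * (θ : ℂ) ^ (2 * k + 1) / (Nat.factorial (2 * k + 1) : ℂ)) := by
      funext k
      rw [pow_succ, pow_mul, hz2, neg_pow, ← pow_mul, hz]
      ring
    rw [hfun]
    exact (Complex.hasSum_sin _).mul_left _
  have hsum := HasSum.even_add_odd (f := fun k : ℕ => (z ^ k / (Nat.factorial k : ℂ)) • P ^ k) he ho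
  have hval : (Real.cos θ : ℂ) • (1 : Matrix n n ℂ) - (I * Real.sin θ) • P =
      Complex.cos (θ : ℂ) • (1 : Matrix n n ℂ) + (-I * Complex.sin (θ : ℂ)) • P := by
    rw [Complex.ofReal_cos, Complex.ofReal_sin, sub_eq_add_neg, ← neg_smul, ← neg_mul]
  rw [hval]
  exact hsum

/-- **`e^{−ibσˣ} = cos b · 𝟙 − i sin b · σˣ`** as a matrix exponential. [cite: BertiniKosProsen2019,
SM §4 eq. (SM-28) (`U_K = e^{−ibσˣ}`)] [cite: NielsenChuang2010, eq. (4.4)] -/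
theorem exp_X_eq_xKick (b : ℝ) :
    NormedSpace.exp ((-(I * b) : ℂ) • Pauli.mat Pauli.X) = xKick b := by
  rw [exp_neg_I_mul_smul_of_mul_self _ (Pauli.mat_mul_self Pauli.X) b]
  rfl

/-- Consistency of the two closed forms: `e^{−ihσᶻ} = cos h · 𝟙 − i sin h · σᶻ` as well.
[cite: NielsenChuang2010, eqs. (4.4), (4.6)] -/
theorem zRot_eq_cos_sub_sin (h : ℝ) :
    zRot h = (Real.cos h : ℂ) • (1 : Matrix Bool Bool ℂ) - (I * Real.sin h) • Pauli.mat Pauli.Z := by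
  rw [← exp_Z_eq_zRot, exp_neg_I_mul_smul_of_mul_self _ (Pauli.mat_mul_self Pauli.Z) h]

/-! ### All four self-dual points `|J| = |b| = π/4`

Bertini–Kos–Prosen place dual-unitarity "at the self dual points `|J| = |b| = π/4`" (SM §4,
eq. (SM-34)). Flipping the sign of `b` is a conjugation by `σᶻ ⊗ σᶻ`, flipping the sign of `J` a
conjugation by `σˣ ⊗ 𝟙` together with `h ↦ −h`; both are single-site dressings, so the
`J = b = π/4` theorem transfers to the other three points. -/

/-- The Pauli matrices are unitary. [cite: NielsenChuang2010, §2.1.3] -/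
theorem pauli_mem_unitaryGroup (Q : Pauli) : Pauli.mat Q ∈ Matrix.unitaryGroup Bool ℂ := by
  rw [Matrix.mem_unitaryGroup_iff, Matrix.star_eq_conjTranspose, Pauli.conjTranspose_mat,
    Pauli.mat_mul_self]

/-- `σᶻ ⊗ σᶻ = diag(s₁ s₂)`. [folklore] -/
private theorem kron_Z_Z_eq_diagonal :
    Pauli.mat Pauli.Z ⊗ₖ Pauli.mat Pauli.Z = diagonal fun p : Bool × Bool => zSign p.1 * zSign p.2 := by
  rw [mat_Z_eq_diagonal, Matrix.diagonal_kronecker_diagonal]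

/-- Flipping the kick: `e^{+ibσˣ} = σᶻ e^{−ibσˣ} σᶻ`. [folklore] -/
private theorem xKick_neg (b : ℝ) : xKick (-b) = Pauli.mat Pauli.Z * xKick b * Pauli.mat Pauli.Z := by
  unfold xKick
  rw [Real.cos_neg, Real.sin_neg, Complex.ofReal_neg, Matrix.mul_sub, Matrix.sub_mul,
    Matrix.mul_smul, Matrix.smul_mul, Matrix.mul_one, Pauli.mat_mul_self, Matrix.mul_smul,
    Matrix.smul_mul, Pauli.mat_mul_mat_mul_mat]
  simp only [Pauli.sign, reduceCtorEq, or_self, if_false, smul_smul]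
  congr 1
  ring

/-- `e^{−ihσᶻ}` commutes with `σᶻ` (both diagonal). [folklore] -/
private theorem zRot_mul_Z (h : ℝ) : zRot h * Pauli.mat Pauli.Z = Pauli.mat Pauli.Z * zRot h := by
  unfold zRot
  rw [mat_Z_eq_diagonal, Matrix.diagonal_mul_diagonal, Matrix.diagonal_mul_diagonal]
  congr 1
  funext a
  ring

/-- `e^{−iJσᶻ⊗σᶻ}` commutes with `σᶻ ⊗ σᶻ` (both diagonal). [folklore] -/
private theorem zzPhase_mul_kron_Z_Z (J : ℝ) :
    zzPhase J * (Pauli.mat Pauli.Z ⊗ₖ Pauli.mat Pauli.Z) =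
      (Pauli.mat Pauli.Z ⊗ₖ Pauli.mat Pauli.Z) * zzPhase J := by
  unfold zzPhase
  rw [kron_Z_Z_eq_diagonal, Matrix.diagonal_mul_diagonal, Matrix.diagonal_mul_diagonal]
  congr 1
  funext p
  ring

/-- **Sign of the kick**: `U_KI(J, −b, h) = (σᶻ ⊗ σᶻ) · U_KI(J, b, h) · (σᶻ ⊗ σᶻ)`.
[cite: BertiniKosProsen2019, SM §4 eq. (SM-34) (the self-dual points are `|J| = |b| = π/4`)] -/
theorem gate_neg_b (J b h : ℝ) :
    gate J (-b) h = (Pauli.mat Pauli.Z ⊗ₖ Pauli.mat Pauli.Z) * gate J b h *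
      (Pauli.mat Pauli.Z ⊗ₖ Pauli.mat Pauli.Z) := by
  have hmid : (zRot h * xKick (-b) * zRot h) ⊗ₖ xKick (-b) =
      (Pauli.mat Pauli.Z ⊗ₖ Pauli.mat Pauli.Z) * ((zRot h * xKick b * zRot h) ⊗ₖ xKick b) *
        (Pauli.mat Pauli.Z ⊗ₖ Pauli.mat Pauli.Z) := by
    rw [← Matrix.mul_kronecker_mul, ← Matrix.mul_kronecker_mul, xKick_neg]
    congr 1
    calc zRot h * (Pauli.mat Pauli.Z * xKick b * Pauli.mat Pauli.Z) * zRot h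
        = (zRot h * Pauli.mat Pauli.Z) * xKick b * (Pauli.mat Pauli.Z * zRot h) := by
          simp only [Matrix.mul_assoc]
      _ = (Pauli.mat Pauli.Z * zRot h) * xKick b * (zRot h * Pauli.mat Pauli.Z) := by
          rw [zRot_mul_Z]
      _ = Pauli.mat Pauli.Z * (zRot h * xKick b * zRot h) * Pauli.mat Pauli.Z := by
          simp only [Matrix.mul_assoc]
  unfold gate
  rw [hmid]
  calc zzPhase J * ((Pauli.mat Pauli.Z ⊗ₖ Pauli.mat Pauli.Z) *
        ((zRot h * xKick b * zRot h) ⊗ₖ xKick b) * (Pauli.mat Pauli.Z ⊗ₖ Pauli.mat Pauli.Z)) * zzPhase J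
      = (zzPhase J * (Pauli.mat Pauli.Z ⊗ₖ Pauli.mat Pauli.Z)) *
          ((zRot h * xKick b * zRot h) ⊗ₖ xKick b) *
          ((Pauli.mat Pauli.Z ⊗ₖ Pauli.mat Pauli.Z) * zzPhase J) := by
        simp only [Matrix.mul_assoc]
    _ = ((Pauli.mat Pauli.Z ⊗ₖ Pauli.mat Pauli.Z) * zzPhase J) *
          ((zRot h * xKick b * zRot h) ⊗ₖ xKick b) *
          (zzPhase J * (Pauli.mat Pauli.Z ⊗ₖ Pauli.mat Pauli.Z)) := by
        rw [zzPhase_mul_kron_Z_Z]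
    _ = (Pauli.mat Pauli.Z ⊗ₖ Pauli.mat Pauli.Z) *
          (zzPhase J * ((zRot h * xKick b * zRot h) ⊗ₖ xKick b) * zzPhase J) *
          (Pauli.mat Pauli.Z ⊗ₖ Pauli.mat Pauli.Z) := by
        simp only [Matrix.mul_assoc]

/-- Flipping the field: `σˣ e^{−ihσᶻ} σˣ = e^{+ihσᶻ}`. [folklore] -/
private theorem X_mul_zRot_mul_X (h : ℝ) :
    Pauli.mat Pauli.X * zRot h * Pauli.mat Pauli.X = zRot (-h) := by
  ext a c
  simp only [zRot, Matrix.mul_apply, Fintype.sum_bool, Matrix.diagonal_apply, Pauli.mat_X_apply,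
    zSign, Complex.ofReal_neg]
  cases a <;> cases c <;> simp

/-- `σˣ` commutes with the kick `e^{−ibσˣ}`. [folklore] -/
private theorem X_mul_xKick (b : ℝ) :
    Pauli.mat Pauli.X * xKick b = xKick b * Pauli.mat Pauli.X := by
  unfold xKick
  rw [Matrix.mul_sub, Matrix.sub_mul, Matrix.mul_smul, Matrix.smul_mul, Matrix.mul_one,
    Matrix.one_mul, Matrix.mul_smul, Matrix.smul_mul, Pauli.mat_mul_self]

/-- Flipping the coupling: `e^{+iJσᶻ⊗σᶻ} = (σˣ ⊗ 𝟙) e^{−iJσᶻ⊗σᶻ} (σˣ ⊗ 𝟙)`. [folklore] -/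
private theorem zzPhase_neg (J : ℝ) :
    zzPhase (-J) = (Pauli.mat Pauli.X ⊗ₖ (1 : Matrix Bool Bool ℂ)) * zzPhase J *
      (Pauli.mat Pauli.X ⊗ₖ (1 : Matrix Bool Bool ℂ)) := by
  ext ⟨a, c⟩ ⟨a', c'⟩
  simp only [zzPhase, Matrix.mul_apply, Fintype.sum_prod_type, Fintype.sum_bool,
    Matrix.diagonal_apply, Matrix.kroneckerMap_apply, Pauli.mat_X_apply, Matrix.one_apply, zSign,
    Complex.ofReal_neg, Prod.mk.injEq]
  cases a <;> cases c <;> cases a' <;> cases c' <;> simp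

/-- **Sign of the coupling**: `U_KI(−J, b, h) = (σˣ ⊗ 𝟙) · U_KI(J, b, −h) · (σˣ ⊗ 𝟙)`.
[cite: BertiniKosProsen2019, SM §4 eqs. (SM-34), (SM-36) (the factor `(σᶻ⊗σᶻ)^{θ_H(−J)}`
distinguishing the sign of `J` at the self-dual points)] -/
theorem gate_neg_J (J b h : ℝ) :
    gate (-J) b h = (Pauli.mat Pauli.X ⊗ₖ (1 : Matrix Bool Bool ℂ)) * gate J b (-h) *
      (Pauli.mat Pauli.X ⊗ₖ (1 : Matrix Bool Bool ℂ)) := by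
  set P : Matrix (Bool × Bool) (Bool × Bool) ℂ := Pauli.mat Pauli.X ⊗ₖ (1 : Matrix Bool Bool ℂ)
    with hP
  have hXX : Pauli.mat Pauli.X * Pauli.mat Pauli.X = 1 := Pauli.mat_mul_self Pauli.X
  have hXXM : ∀ M : Matrix Bool Bool ℂ, Pauli.mat Pauli.X * (Pauli.mat Pauli.X * M) = M :=
    fun M => by rw [← Matrix.mul_assoc, hXX, Matrix.one_mul]
  have hPP : P * P = 1 := by
    rw [hP, ← Matrix.mul_kronecker_mul, hXX, Matrix.mul_one, Matrix.one_kronecker_one]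
  have hPPM : ∀ M : Matrix (Bool × Bool) (Bool × Bool) ℂ, P * (P * M) = M :=
    fun M => by rw [← Matrix.mul_assoc, hPP, Matrix.one_mul]
  have hXzX : Pauli.mat Pauli.X * zRot (-h) * Pauli.mat Pauli.X = zRot h := by
    rw [X_mul_zRot_mul_X, neg_neg]
  have hXkX : Pauli.mat Pauli.X * xKick b * Pauli.mat Pauli.X = xKick b := by
    rw [X_mul_xKick, Matrix.mul_assoc, hXX, Matrix.mul_one]
  have hmid1 : Pauli.mat Pauli.X * (zRot (-h) * xKick b * zRot (-h)) * Pauli.mat Pauli.X =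
      zRot h * xKick b * zRot h := by
    conv_rhs => rw [← hXzX, ← hXkX]
    simp only [Matrix.mul_assoc, hXXM]
  have hmid : P * ((zRot (-h) * xKick b * zRot (-h)) ⊗ₖ xKick b) * P =
      (zRot h * xKick b * zRot h) ⊗ₖ xKick b := by
    rw [hP, ← Matrix.mul_kronecker_mul, ← Matrix.mul_kronecker_mul, Matrix.one_mul,
      Matrix.mul_one, hmid1]
  unfold gate
  rw [zzPhase_neg, ← hP, ← hmid]
  simp only [Matrix.mul_assoc, hPPM]

/-- **Dual-unitarity at all four self-dual points: `|J| = |b| = π/4`, every `h`.**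
[cite: BertiniKosProsen2019, SM §4 eqs. (SM-34)–(SM-36) ("at the self dual points
`|J| = |b| = π/4`" the gate is of the dual-unitary form (23))] [cite: FischerEtAl2026, main text
("For J = b = π/4, the gates are dual unitary for any choice of h")] -/
theorem isDualUnitary_gate_of_abs_eq {J b : ℝ} (hJ : |J| = Real.pi / 4) (hb : |b| = Real.pi / 4)
    (h : ℝ) : IsDualUnitary (gate J b h) := by
  have hπ : (0 : ℝ) ≤ Real.pi / 4 := by positivity
  have hZ := pauli_mem_unitaryGroup Pauli.Z
  have hX := pauli_mem_unitaryGroup Pauli.X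
  have h1 : (1 : Matrix Bool Bool ℂ) ∈ Matrix.unitaryGroup Bool ℂ := Submonoid.one_mem _
  -- the two points with `J = +π/4`, for every field
  have hJpos : ∀ {b' : ℝ}, |b'| = Real.pi / 4 → ∀ h' : ℝ,
      IsDualUnitary (gate (Real.pi / 4) b' h') := by
    intro b' hb' h'
    rcases (abs_eq hπ).mp hb' with rfl | rfl
    · exact isDualUnitary_gate_selfDual h'
    · rw [gate_neg_b]
      exact (isDualUnitary_gate_selfDual h').conj_local hZ hZ hZ hZ
  rcases (abs_eq hπ).mp hJ with rfl | rfl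
  · exact hJpos hb h
  · rw [gate_neg_J]
    exact (hJpos hb (-h)).conj_local hX h1 hX h1

/-! ### The light-cone channel of the self-dual gate: `M₊(σˣ) = cos(2h) · σˣ`

Fischer et al. eq. (2): on the light cone `n = t` the infinite-temperature autocorrelator is
`C_t(t) = [cos(2h)]^t`. By Bertini–Kos–Prosen's Property 2 (eq. (17): the light-cone correlator
equals `(1/d) tr[M₊^{#layers}(a^β) a^α]` — a many-body reduction NOT formalised in the tree) this
is a statement about the one-gate channel `M₊(a) = ½ tr₁[U†(a ⊗ 𝟙)U]` (eq. (18); `DualUnitary.mPlus`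
of `DualUnitaryGates.lean`): for the `J = b = π/4` kicked-Ising gate, `σˣ` is an eigen-operator of
`M₊` with eigenvalue `cos 2h`, for every `h`. That one-gate fact is proved exactly below; the field
enters only through the Heisenberg rotation `e^{ihσᶻ} σˣ e^{−ihσᶻ} = cos(2h) σˣ − sin(2h) σʸ` of
the argument, and the Clifford point maps `σˣ ↦ σˣ`, `σʸ ↦ 0`. -/

section LightConeChannel

variable {n : Type*} [Fintype n] [DecidableEq n]

omit [DecidableEq n] in
/-- `tr₁` is additive. [folklore] -/
private theorem traceLeft_add' (M N : Matrix (n × n) (n × n) ℂ) :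
    traceLeft (M + N) = traceLeft M + traceLeft N := by
  ext b b'
  simp [traceLeft_apply, Finset.sum_add_distrib]

omit [DecidableEq n] in
/-- `tr₁` is homogeneous. [folklore] -/
private theorem traceLeft_smul' (c : ℂ) (M : Matrix (n × n) (n × n) ℂ) :
    traceLeft (c • M) = c • traceLeft M := by
  ext b b'
  simp [traceLeft_apply, Finset.mul_sum]

/-- `M₊` is additive in its argument. [cite: BertiniKosProsen2019, eq. (18) ("the linear maps over
End(ℂ^d)")] -/
theorem _root_.Literature.MathematicalPhysics.QuantumLattice.DualUnitary.mPlus_add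
    (U : Matrix (n × n) (n × n) ℂ) (a a' : Matrix n n ℂ) :
    mPlus U (a + a') = mPlus U a + mPlus U a' := by
  unfold mPlus
  rw [Matrix.add_kronecker, Matrix.mul_add, Matrix.add_mul, traceLeft_add', smul_add]

/-- `M₊` is homogeneous in its argument. [cite: BertiniKosProsen2019, eq. (18)] -/
theorem _root_.Literature.MathematicalPhysics.QuantumLattice.DualUnitary.mPlus_smul_arg
    (U : Matrix (n × n) (n × n) ℂ) (c : ℂ) (a : Matrix n n ℂ) :
    mPlus U (c • a) = c • mPlus U a := by
  unfold mPlus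
  rw [Matrix.smul_kronecker, Matrix.mul_smul, Matrix.smul_mul, traceLeft_smul', smul_comm]

/-- `M₊` respects subtraction. [cite: BertiniKosProsen2019, eq. (18)] -/
theorem _root_.Literature.MathematicalPhysics.QuantumLattice.DualUnitary.mPlus_sub
    (U : Matrix (n × n) (n × n) ℂ) (a a' : Matrix n n ℂ) :
    mPlus U (a - a') = mPlus U a - mPlus U a' := by
  rw [sub_eq_add_neg, mPlus_add, ← neg_one_smul ℂ a', mPlus_smul_arg, neg_one_smul,
    ← sub_eq_add_neg]

/-- A global phase of the gate drops out of `M₊`. [cite: BertiniKosProsen2019, eqs. (18), (23)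
(the `e^{iφ}` of the parametrisation)] -/
theorem _root_.Literature.MathematicalPhysics.QuantumLattice.DualUnitary.mPlus_phase_smul
    {c : ℂ} (hc : star c * c = 1) (V : Matrix (n × n) (n × n) ℂ) (a : Matrix n n ℂ) :
    mPlus (c • V) a = mPlus V a := by
  unfold mPlus
  rw [Matrix.conjTranspose_smul, Matrix.smul_mul, Matrix.smul_mul, Matrix.mul_smul, smul_smul, hc,
    one_smul]

/-- `tr₁[(D ⊗ 𝟙)† M (D ⊗ 𝟙)] = tr₁ M` when `D D† = 𝟙` (cyclicity of the partial trace on the traced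
factor). [folklore] -/
private theorem traceLeft_kron_one_conj {D : Matrix n n ℂ} (hD : D * Dᴴ = 1)
    (M : Matrix (n × n) (n × n) ℂ) :
    traceLeft ((D ⊗ₖ (1 : Matrix n n ℂ))ᴴ * M * (D ⊗ₖ (1 : Matrix n n ℂ))) = traceLeft M := by
  have hD' : ∀ c c' : n, ∑ a, D c' a * star (D c a) = if c' = c then 1 else 0 := fun c c' => by
    have := congr_fun (congr_fun hD c') c
    simpa [Matrix.mul_apply, Matrix.conjTranspose_apply, Matrix.one_apply] using this
  rw [Matrix.conjTranspose_kronecker, Matrix.conjTranspose_one]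
  ext b b'
  simp only [traceLeft_apply, Matrix.mul_apply, Matrix.kroneckerMap_apply, Matrix.one_apply,
    Fintype.sum_prod_type, mul_ite, mul_one, mul_zero, ite_mul, zero_mul, Finset.sum_ite_eq,
    Finset.sum_ite_eq', Finset.mem_univ, if_true, Finset.sum_mul]
  have key : ∀ c c' : n, ∑ a, Dᴴ a c * M (c, b) (c', b') * D c' a =
      M (c, b) (c', b') * (if c' = c then 1 else 0) := by
    intro c c'
    rw [← hD' c c', Finset.mul_sum]
    refine Finset.sum_congr rfl fun a _ => ?_
    rw [Matrix.conjTranspose_apply]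
    ring
  calc ∑ a, ∑ c', ∑ c, Dᴴ a c * M (c, b) (c', b') * D c' a
      = ∑ c', ∑ c, ∑ a, Dᴴ a c * M (c, b) (c', b') * D c' a :=
        Finset.sum_comm.trans (Finset.sum_congr rfl fun _ _ => Finset.sum_comm)
    _ = ∑ c', ∑ c, M (c, b) (c', b') * (if c' = c then 1 else 0) :=
        Finset.sum_congr rfl fun c' _ => Finset.sum_congr rfl fun c _ => key c c'
    _ = ∑ c, M (c, b) (c, b') := by
        simp only [mul_ite, mul_one, mul_zero, Finset.sum_ite_eq, Finset.mem_univ, if_true]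

/-- **Dressing the first site moves into the argument of `M₊`**: for `D D† = 𝟙`,
`M₊[(D ⊗ 𝟙) V (D ⊗ 𝟙)](a) = M₊[V](D† a D)`. [cite: BertiniKosProsen2019, eq. (18) with the
single-site dressings of eq. (23)] -/
theorem _root_.Literature.MathematicalPhysics.QuantumLattice.DualUnitary.mPlus_kron_one_conj
    {D : Matrix n n ℂ} (hD : D * Dᴴ = 1) (V : Matrix (n × n) (n × n) ℂ) (a : Matrix n n ℂ) :
    mPlus ((D ⊗ₖ (1 : Matrix n n ℂ)) * V * (D ⊗ₖ (1 : Matrix n n ℂ))) a = mPlus V (Dᴴ * a * D) := by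
  unfold mPlus
  congr 1
  have ha : (D ⊗ₖ (1 : Matrix n n ℂ))ᴴ * (a ⊗ₖ (1 : Matrix n n ℂ)) * (D ⊗ₖ (1 : Matrix n n ℂ)) =
      (Dᴴ * a * D) ⊗ₖ (1 : Matrix n n ℂ) := by
    rw [Matrix.conjTranspose_kronecker, Matrix.conjTranspose_one, ← Matrix.mul_kronecker_mul,
      ← Matrix.mul_kronecker_mul, Matrix.mul_one, Matrix.mul_one]
  calc traceLeft (((D ⊗ₖ (1 : Matrix n n ℂ)) * V * (D ⊗ₖ (1 : Matrix n n ℂ)))ᴴ *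
        (a ⊗ₖ (1 : Matrix n n ℂ)) * ((D ⊗ₖ (1 : Matrix n n ℂ)) * V * (D ⊗ₖ (1 : Matrix n n ℂ))))
      = traceLeft ((D ⊗ₖ (1 : Matrix n n ℂ))ᴴ *
          (Vᴴ * ((D ⊗ₖ (1 : Matrix n n ℂ))ᴴ * (a ⊗ₖ (1 : Matrix n n ℂ)) * (D ⊗ₖ (1 : Matrix n n ℂ))) * V) *
          (D ⊗ₖ (1 : Matrix n n ℂ))) := by
        rw [Matrix.conjTranspose_mul, Matrix.conjTranspose_mul]
        simp only [Matrix.mul_assoc]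
    _ = traceLeft (Vᴴ * ((Dᴴ * a * D) ⊗ₖ (1 : Matrix n n ℂ)) * V) := by
        rw [ha, traceLeft_kron_one_conj hD]

end LightConeChannel

/-- `zRot h · (zRot h)† = 𝟙`. [folklore] -/
private theorem zRot_mul_conjTranspose (h : ℝ) : zRot h * (zRot h)ᴴ = 1 := by
  have := Matrix.mem_unitaryGroup_iff.mp (zRot_mem_unitaryGroup h)
  rwa [Matrix.star_eq_conjTranspose] at this

/-- **Heisenberg rotation of `σˣ` about `z`**: `e^{+ihσᶻ} σˣ e^{−ihσᶻ} = cos(2h) σˣ − sin(2h) σʸ`.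
[cite: NielsenChuang2010, eq. (4.6) and Exercise 4.7 (conjugation by `R_z`)] -/
theorem conjTranspose_zRot_mul_X_mul_zRot (h : ℝ) :
    (zRot h)ᴴ * Pauli.mat Pauli.X * zRot h =
      (Real.cos (2 * h) : ℂ) • Pauli.mat Pauli.X - (Real.sin (2 * h) : ℂ) • Pauli.mat Pauli.Y := by
  have hd : ∀ a : Bool, star (cexp (-(I * h * zSign a))) = cexp (I * h * zSign a) := by
    intro a
    rw [Complex.star_def, ← Complex.exp_conj]
    congr 1
    cases a <;> simp [zSign, Complex.conj_ofReal]
  have e2 : cexp (I * h) ^ 2 = Complex.cos (2 * (h : ℂ)) + Complex.sin (2 * (h : ℂ)) * I := by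
    rw [sq, ← Complex.exp_add, Complex.cos_add_sin_I]
    congr 1
    ring
  have e2' : cexp (-(I * h)) ^ 2 = Complex.cos (2 * (h : ℂ)) - Complex.sin (2 * (h : ℂ)) * I := by
    rw [sq, ← Complex.exp_add, show Complex.cos (2 * (h : ℂ)) - Complex.sin (2 * (h : ℂ)) * I =
      Complex.cos (-(2 * (h : ℂ))) + Complex.sin (-(2 * (h : ℂ))) * I by
        rw [Complex.cos_neg, Complex.sin_neg]; ring, Complex.cos_add_sin_I]
    congr 1
    ring
  ext a c
  rw [zRot, Matrix.diagonal_conjTranspose, Matrix.mul_diagonal, Matrix.diagonal_mul, Pi.star_apply,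
    hd]
  cases a <;> cases c <;> simp [zSign, Matrix.sub_apply] <;>
    first | linear_combination e2 | linear_combination e2'

/-- Diagonal of `S ⊗ S`: `(1, i, i, −1)`. [folklore] -/
private def sKronSign (p : Bool × Bool) : ℂ := (if p.1 then I else 1) * (if p.2 then I else 1)

/-- `S ⊗ S = diag(sKronSign)`. [folklore] -/
private theorem sGate_kronecker_sGate : sGate ⊗ₖ sGate = diagonal sKronSign := by
  unfold sGate sKronSign
  rw [Matrix.diagonal_kronecker_diagonal]

/-- The phase-free Clifford gate `W = (S ⊗ S) · C · (S ⊗ S)` at the self-dual point. [folklore] -/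
private def cliffordW : Matrix (Bool × Bool) (Bool × Bool) ℂ :=
  (sGate ⊗ₖ sGate) * core * (sGate ⊗ₖ sGate)

/-- Entries of `W`. [folklore] -/
private theorem cliffordW_apply (p q : Bool × Bool) :
    cliffordW p q = sKronSign p * ((1 / 2 : ℂ) * ((if p.1 && p.2 then -1 else 1) *
      ((if p.1 = q.1 then 1 else -I) * (if p.2 = q.2 then 1 else -I)) *
      (if q.1 && q.2 then -1 else 1))) * sKronSign q := by
  unfold cliffordW
  rw [sGate_kronecker_sGate, Matrix.mul_diagonal, Matrix.diagonal_mul, core_apply]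

/-- `U_KI(π/4, π/4, 0) = e^{−iπ/2} · W`. [cite: BertiniKosProsen2019, SM §4 eqs. (SM-34)–(SM-36)] -/
private theorem gate_selfDual_zero_eq_smul_cliffordW :
    gate (Real.pi / 4) (Real.pi / 4) 0 =
      (cexp (-(I * (Real.pi / 4 : ℝ))) * cexp (-(I * (Real.pi / 4 : ℝ)))) • cliffordW :=
  gate_selfDual_zero

/-- `M₊` at the Clifford point fixes `σˣ`: `M₊[W](σˣ) = σˣ` (a `4 × 4` check over `ℤ[i]/2`).
[cite: FischerEtAl2026, eq. (2) at `h = 0` ("the autocorrelation function is constant at the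
integrable Clifford point `h = 0`")] -/
private theorem mPlus_cliffordW_X : mPlus cliffordW (Pauli.mat Pauli.X) = Pauli.mat Pauli.X := by
  ext b b'
  simp only [mPlus, Fintype.card_bool, Nat.cast_ofNat, Matrix.smul_apply, smul_eq_mul,
    traceLeft_apply, Matrix.mul_apply, Matrix.conjTranspose_apply, cliffordW_apply, sKronSign,
    Matrix.kroneckerMap_apply, Matrix.one_apply, Pauli.mat_X_apply, Fintype.sum_prod_type,
    Fintype.sum_bool]
  cases b <;> cases b' <;> norm_num [Complex.ext_iff]

/-- `M₊` at the Clifford point kills `σʸ`: `M₊[W](σʸ) = 0`. [folklore] -/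
private theorem mPlus_cliffordW_Y : mPlus cliffordW (Pauli.mat Pauli.Y) = 0 := by
  ext b b'
  simp only [mPlus, Fintype.card_bool, Nat.cast_ofNat, Matrix.smul_apply, smul_eq_mul,
    traceLeft_apply, Matrix.mul_apply, Matrix.conjTranspose_apply, cliffordW_apply, sKronSign,
    Matrix.kroneckerMap_apply, Matrix.one_apply, Pauli.mat_Y_apply, Fintype.sum_prod_type,
    Fintype.sum_bool, Matrix.zero_apply]
  cases b <;> cases b' <;> norm_num [Complex.ext_iff]

/-- The global phase of `U_KI(π/4, π/4, 0)` is unimodular. [folklore] -/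
private theorem selfDual_phase_unimodular :
    star (cexp (-(I * (Real.pi / 4 : ℝ))) * cexp (-(I * (Real.pi / 4 : ℝ)))) *
      (cexp (-(I * (Real.pi / 4 : ℝ))) * cexp (-(I * (Real.pi / 4 : ℝ)))) = 1 := by
  have h1 := phase_mul_star (Real.pi / 4)
  rw [star_mul]
  calc star (cexp (-(I * (Real.pi / 4 : ℝ)))) * star (cexp (-(I * (Real.pi / 4 : ℝ)))) *
        (cexp (-(I * (Real.pi / 4 : ℝ))) * cexp (-(I * (Real.pi / 4 : ℝ))))
      = (cexp (-(I * (Real.pi / 4 : ℝ))) * star (cexp (-(I * (Real.pi / 4 : ℝ))))) *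
          (cexp (-(I * (Real.pi / 4 : ℝ))) * star (cexp (-(I * (Real.pi / 4 : ℝ))))) := by ring
    _ = 1 := by rw [h1, one_mul]

/-- `M₊` at `J = b = π/4`, `h = 0` maps `σˣ ↦ σˣ`. [cite: FischerEtAl2026, eq. (2) at `h = 0`] -/
theorem mPlus_gate_selfDual_zero_X :
    mPlus (gate (Real.pi / 4) (Real.pi / 4) 0) (Pauli.mat Pauli.X) = Pauli.mat Pauli.X := by
  rw [gate_selfDual_zero_eq_smul_cliffordW, mPlus_phase_smul selfDual_phase_unimodular,
    mPlus_cliffordW_X]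

/-- `M₊` at `J = b = π/4`, `h = 0` maps `σʸ ↦ 0`. [folklore] -/
private theorem mPlus_gate_selfDual_zero_Y :
    mPlus (gate (Real.pi / 4) (Real.pi / 4) 0) (Pauli.mat Pauli.Y) = 0 := by
  rw [gate_selfDual_zero_eq_smul_cliffordW, mPlus_phase_smul selfDual_phase_unimodular,
    mPlus_cliffordW_Y]

/-- **`σˣ` is an eigen-operator of the light-cone channel of the self-dual kicked-Ising gate, with
eigenvalue `cos 2h`:** `M₊[U_KI(π/4, π/4, h)](σˣ) = cos(2h) · σˣ` for every `h`.
[cite: FischerEtAl2026, eq. (2) (`C_n(t) = [cos(2h)]^t` if `n = t`) and text ("The decay rate of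
`C_n(t)` as a function of `h` … is a universal quantity independent of the system size")]
[cite: BertiniKosProsen2019, eq. (18) (`M₊`) and Property 2 / eq. (17)] -/
theorem mPlus_gate_selfDual_X (h : ℝ) :
    mPlus (gate (Real.pi / 4) (Real.pi / 4) h) (Pauli.mat Pauli.X) =
      (Real.cos (2 * h) : ℂ) • Pauli.mat Pauli.X := by
  rw [gate_eq_conj_gate_zero, mPlus_kron_one_conj (zRot_mul_conjTranspose h),
    conjTranspose_zRot_mul_X_mul_zRot, mPlus_sub, mPlus_smul_arg, mPlus_smul_arg,
    mPlus_gate_selfDual_zero_X, mPlus_gate_selfDual_zero_Y, smul_zero, sub_zero]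

/-- Iterating the channel: `M₊^t(σˣ) = [cos(2h)]^t · σˣ`. [cite: FischerEtAl2026, eq. (2)]
[cite: BertiniKosProsen2019, Property 2 / eq. (17) (one factor of `M_ν` per layer)] -/
theorem iterate_mPlus_gate_selfDual_X (h : ℝ) (t : ℕ) :
    (mPlus (gate (Real.pi / 4) (Real.pi / 4) h))^[t] (Pauli.mat Pauli.X) =
      ((Real.cos (2 * h) : ℂ) ^ t) • Pauli.mat Pauli.X := by
  induction t with
  | zero => rw [Function.iterate_zero, id, pow_zero, one_smul]
  | succ t ih =>
      rw [Function.iterate_succ_apply', ih, mPlus_smul_arg, mPlus_gate_selfDual_X, smul_smul,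
        pow_succ]

/-- **The printed light-cone decay, at the level of the one-gate channel**:
`½ Tr[σˣ · M₊^t(σˣ)] = [cos(2h)]^t` for the `J = b = π/4` kicked-Ising gate and every `h`. Under
Bertini–Kos–Prosen's Property 2 (eq. (17), the reduction of the many-body light-cone correlator to
`(1/d) tr[M₊^{#layers}(a^β) a^α]`, which is NOT formalised in the tree) this is Fischer et al.'s
exactly-verifiable signal `C_t(t) = [cos(2h)]^t` (one brickwork layer per Floquet step): constant at
the Clifford point `h = 0`, exponentially decaying otherwise.
[cite: FischerEtAl2026, eq. (2) and text ("On the light cone, the autocorrelation function is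
constant at the integrable Clifford point `h = 0`, but otherwise decays exponentially in time")]
[cite: BertiniKosProsen2019, Property 2 / eq. (17)] -/
theorem half_trace_X_mul_iterate_mPlus_gate_selfDual (h : ℝ) (t : ℕ) :
    (1 / 2 : ℂ) * (Pauli.mat Pauli.X * (mPlus (gate (Real.pi / 4) (Real.pi / 4) h))^[t]
      (Pauli.mat Pauli.X)).trace = (Real.cos (2 * h) : ℂ) ^ t := by
  rw [iterate_mPlus_gate_selfDual_X, Matrix.mul_smul, Matrix.trace_smul, Pauli.trace_mat_mul_mat,
    if_pos rfl, smul_eq_mul]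
  ring

end KickedIsing

end DualUnitary

end Literature.MathematicalPhysics.QuantumLattice
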